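import Literature.MathematicalPhysics.QuantumManyBody.PeriodicBoseGas
import Literature.MathematicalPhysics.QuantumManyBody.TorusPoincareInequality
import Literature.MathematicalPhysics.QuantumManyBody.PeriodicBoseGasMomentumSector
import Literature.MathematicalPhysics.QuantumManyBody.BoseGasDirichletWall
import Summits.AtomisticToContinuum.BoseEinsteinCondensation.Theses.BECSectorPoincareTwoScale
import HarnessLib

/-!
# `GPWindowSectorGap` (support item stmt-AtomisticToContinuum-9097 of route BECSectorPoincareTwoScale):
the free kinetic floor of a non-zero Bloch sector

Helpers for the support item
`Summit.AtomisticToContinuum.BoseEinsteinCondensation.Theses.BECSectorPoincareTwoScale.GPWindowSectorGap`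
("every Bloch-`k` periodic trial state of `n` bosons on the torus of side `ℓ`, `k = (2π/ℓ)m ≠ 0`, has
`periodicEnergy ≥ E₀^per(n,ℓ) + θ/ℓ²` for `n·a ≤ M²ℓ`"). The item's own informal text names the two
ingredients of the Bogoliubov gap: the BBCS excitation spectrum (a Gross–Pitaevskii theorem for `V ∈ L³`,
not available for hard cores) and "`n₊ ≥ 1` on `k ≠ 0` sectors". This file proves the second ingredient
in the tree's variational vocabulary and everything that follows from it alone:

* `gpw_hasTotalMomentum_iff` — the Bloch condition as inlined in the route items is
  `HasTotalMomentum ((2π/ℓ)m)` of `PeriodicBoseGasMomentumSector.lean`;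
* `gpw_configFourierCoeff_zero_eq_zero` — a Bloch state with `m ≠ 0` has zero mean on the cell
  (shift all particles by the half period `s = ℓ m/(2|m|²)`: the state changes sign, the mean does not);
* `gpw_kinetic_floor`, `gpw_energy_floor` — **`(2π/ℓ)² ≤ ∫_cell |∇Ψ|² ≤ periodicEnergy v Ψ`** for every
  normalised Bloch state with `m ≠ 0` (torus Poincaré inequality `lintegral_cellN_normSq_le` at zero
  mean: the free gas has the gap `(2π/ℓ)²` above the constant in EVERY particle number, i.e. `n₊ ≥ 1`);
* `gpw_sectorGap_of_groundState_le` — hence the item's conclusion whenever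
  `E₀^per(n,ℓ) + θ/ℓ² ≤ (2π/ℓ)²`;
* `gpw_free` — the item's full body for the free gas `v = 0` (all `n`, `θ = 4π²`, any `ℓ₀`), and
  `gpw_of_le_one` — for every `v` and `n ≤ 1` (`E₀^per = 0`), `θ ≤ 4π²`.

What is NOT here (and why the item is not closed by this file): for `2 ≤ n ≤ M²ℓ/a` the ground-state
energy `E₀^per(n,ℓ) ≍ 4πa n²/ℓ³` exceeds `(2π/ℓ)²` as soon as `n² a ≳ ℓ`, and the statement becomes the
uniform (in `na/ℓ ∈ (0, M²]` and in `n`) Bogoliubov sector gap of the interacting gas — a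
Gross–Pitaevskii-regime theorem for `V ∈ L³` (BoccatoEtAl2019Acta Thm 1.1, per fixed `na/ℓ`) and an
open problem for the hard cores admitted by `IsRepulsiveFiniteRange`. [folklore]
-/

noncomputable section

namespace Summit.AtomisticToContinuum.BoseEinsteinCondensation.Theorems

open MeasureTheory
open scoped ENNReal NNReal
open Literature.MathematicalPhysics.QuantumManyBody.BoseGas

variable {n : ℕ} {ℓ : ℝ}

/-- The Bloch phase of the route items is the character of `HasTotalMomentum` at `k = (2π/ℓ) m`:
`∑ⱼ ((2π/ℓ)m)ⱼ sⱼ = (2π/ℓ) ∑ₜ mₜ sₜ`. [folklore] -/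
theorem gpw_sum_latticeVec_mul (ℓ : ℝ) (m : Fin 3 → ℤ) (s : Space) :
    (∑ j, (latticeVec (2 * Real.pi / ℓ) m) j * s j) = 2 * Real.pi / ℓ * ∑ t, (m t : ℝ) * s t := by
  rw [Finset.mul_sum]
  exact Finset.sum_congr rfl fun t _ => by simp only [latticeVec, PiLp.toLp_apply]; ring

/-- **The inlined Bloch condition is `HasTotalMomentum ((2π/ℓ)m)`.** The hypothesis
`Ψ(X + s) = e^{i(2π/ℓ) m·s} Ψ(X)` (all particles translated by `s ∈ ℝ³`) written verbatim as in the
route items is the total-momentum condition of `PeriodicBoseGasMomentumSector.lean` at the dual-lattice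
point `k = (2π/ℓ) m`. [folklore] -/
theorem gpw_hasTotalMomentum_iff (ℓ : ℝ) (m : Fin 3 → ℤ) (ψ : Config n → ℂ) :
    (∀ (X : Config n) (s : EuclideanSpace ℝ (Fin 3)),
        ψ (fun j => X j + s) =
          Complex.exp (Complex.I * ↑(2 * Real.pi / ℓ * ∑ t : Fin 3, (m t : ℝ) * s t)) * ψ X) ↔
      HasTotalMomentum (latticeVec (2 * Real.pi / ℓ) m) ψ := by
  constructor
  · intro h s X
    rw [h X s, gpw_sum_latticeVec_mul]
  · intro h X s
    rw [h s X, gpw_sum_latticeVec_mul]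

/-- **A Bloch state with `m ≠ 0` has zero mean on the cell** (`ĉ₀(Ψ) = 0`): translating every
particle by the half period `s = ℓ m / (2|m|²)` multiplies `Ψ` by `e^{iπ} = -1`, while the mean over the
cell of a periodic function is translation invariant (`configFourierCoeff_translate`). [folklore] -/
theorem gpw_configFourierCoeff_zero_eq_zero (hℓ : 0 < ℓ) {m : Fin 3 → ℤ} (hm : m ≠ 0)
    {ψ : Config n → ℂ} (hcont : Continuous ψ) (hper : IsTorusPeriodic ℓ ψ)
    (hB : ∀ (X : Config n) (s : EuclideanSpace ℝ (Fin 3)),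
        ψ (fun j => X j + s) =
          Complex.exp (Complex.I * ↑(2 * Real.pi / ℓ * ∑ t : Fin 3, (m t : ℝ) * s t)) * ψ X) :
    configFourierCoeff ℓ ψ 0 = 0 := by
  -- the squared length of `m`
  set S : ℝ := ∑ t, (m t : ℝ) ^ 2 with hS
  have hSpos : 0 < S := by
    obtain ⟨t, ht⟩ : ∃ t, m t ≠ 0 := Function.ne_iff.mp hm
    have h1 : (0 : ℝ) < (m t : ℝ) ^ 2 := by
      have : (m t : ℝ) ≠ 0 := by exact_mod_cast ht
      positivity
    exact lt_of_lt_of_le h1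
      (Finset.single_le_sum (f := fun t => (m t : ℝ) ^ 2) (fun t _ => sq_nonneg _) (Finset.mem_univ t))
  -- the half-period shift along `m`
  set s : Space := WithLp.toLp 2 fun t => ℓ / (2 * S) * (m t : ℝ) with hs
  have hphase : 2 * Real.pi / ℓ * ∑ t : Fin 3, (m t : ℝ) * s t = Real.pi := by
    have hsum : ∑ t : Fin 3, (m t : ℝ) * s t = ℓ / (2 * S) * S := by
      rw [hS, Finset.mul_sum]
      exact Finset.sum_congr rfl fun t _ => by simp only [hs, PiLp.toLp_apply]; ring
    rw [hsum]
    field_simp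
  have hshift : ∀ X : Config n, ψ (X + fun _ => s) = -ψ X := by
    intro X
    have h := hB X s
    rw [hphase] at h
    have hX : (fun j => X j + s) = X + fun _ => s := rfl
    rw [hX] at h
    rw [h, mul_comm Complex.I, Complex.exp_pi_mul_I, neg_one_mul]
  -- the mean is translation invariant and changes sign: it vanishes
  have h0 := configFourierCoeff_translate hℓ hper (fun _ => s) 0
  have hfun : (fun X => ψ (X + fun _ => s)) = -ψ := funext hshift
  have hneg : configFourierCoeff ℓ (-ψ) 0 = -configFourierCoeff ℓ ψ 0 := by
    rw [configFourierCoeff_zero hℓ hcont.neg.aestronglyMeasurable,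
      configFourierCoeff_zero hℓ hcont.aestronglyMeasurable]
    simp only [Pi.neg_apply, integral_neg, smul_neg]
  rw [hfun, hneg, UnitAddTorus.mFourier_zero, ContinuousMap.one_apply, one_mul] at h0
  have h2 : (2 : ℂ) * configFourierCoeff ℓ ψ 0 = 0 := by linear_combination -h0
  simpa using h2

/-- **The free kinetic floor of a non-zero Bloch sector ("`n₊ ≥ 1` on `k ≠ 0` sectors").** For every
normalised periodic trial state of `n` bosons on the torus of side `ℓ > 0` in the Bloch sector
`k = (2π/ℓ)m`, `m ≠ 0`: `(2π/ℓ)² ≤ ∫_cell |∇Ψ|²`, uniformly in `n` (torus Poincaré inequality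
`‖Ψ‖² ≤ |cell| |ĉ₀(Ψ)|² + (ℓ/2π)² ∫|∇Ψ|²` at `ĉ₀(Ψ) = 0`; sharp on `∑ⱼ e^{ik·xⱼ}`). [folklore] -/
theorem gpw_kinetic_floor (hℓ : 0 < ℓ) {m : Fin 3 → ℤ} (hm : m ≠ 0) (Ψ : PeriodicTrialState n ℓ)
    (hB : ∀ (X : Config n) (s : EuclideanSpace ℝ (Fin 3)),
        Ψ.ψ (fun j => X j + s) =
          Complex.exp (Complex.I * ↑(2 * Real.pi / ℓ * ∑ t : Fin 3, (m t : ℝ) * s t)) * Ψ.ψ X) :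
    ENNReal.ofReal ((2 * Real.pi / ℓ) ^ 2) ≤ ∫⁻ X in cellN n ℓ, kineticDensity Ψ.ψ X := by
  have hper : IsTorusPeriodic ℓ Ψ.ψ := Ψ.periodic
  have h := lintegral_cellN_normSq_le hℓ Ψ.contDiff hper
  rw [Ψ.norm_eq, gpw_configFourierCoeff_zero_eq_zero hℓ hm Ψ.contDiff.continuous hper hB, nnnorm_zero,
    ENNReal.coe_zero, zero_pow two_ne_zero, mul_zero, zero_add] at h
  have hc : ENNReal.ofReal ((2 * Real.pi / ℓ) ^ 2) * ENNReal.ofReal ((ℓ / (2 * Real.pi)) ^ 2) = 1 := by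
    rw [← ENNReal.ofReal_mul (sq_nonneg _), ← mul_pow]
    have h1 : 2 * Real.pi / ℓ * (ℓ / (2 * Real.pi)) = 1 := by
      field_simp
    rw [h1, one_pow, ENNReal.ofReal_one]
  calc ENNReal.ofReal ((2 * Real.pi / ℓ) ^ 2)
      = ENNReal.ofReal ((2 * Real.pi / ℓ) ^ 2) * 1 := (mul_one _).symm
    _ ≤ ENNReal.ofReal ((2 * Real.pi / ℓ) ^ 2) *
          (ENNReal.ofReal ((ℓ / (2 * Real.pi)) ^ 2) * ∫⁻ X in cellN n ℓ, kineticDensity Ψ.ψ X) := by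
        gcongr
    _ = ∫⁻ X in cellN n ℓ, kineticDensity Ψ.ψ X := by rw [← mul_assoc, hc, one_mul]

/-- **Energy floor of a non-zero Bloch sector**: `(2π/ℓ)² ≤ periodicEnergy v Ψ` for every pair
potential `v ≥ 0` and every normalised Bloch state with `m ≠ 0` (the interaction is non-negative).
[folklore] -/
theorem gpw_energy_floor (v : ℝ → ℝ≥0∞) (hℓ : 0 < ℓ) {m : Fin 3 → ℤ} (hm : m ≠ 0)
    (Ψ : PeriodicTrialState n ℓ)
    (hB : ∀ (X : Config n) (s : EuclideanSpace ℝ (Fin 3)),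
        Ψ.ψ (fun j => X j + s) =
          Complex.exp (Complex.I * ↑(2 * Real.pi / ℓ * ∑ t : Fin 3, (m t : ℝ) * s t)) * Ψ.ψ X) :
    ENNReal.ofReal ((2 * Real.pi / ℓ) ^ 2) ≤ periodicEnergy v Ψ :=
  (gpw_kinetic_floor hℓ hm Ψ hB).trans (lintegral_mono fun _ => le_self_add)

/-- **The item's conclusion below the free floor.** If `E₀^per(n,ℓ) + θ/ℓ² ≤ (2π/ℓ)²` then every Bloch
state with `m ≠ 0` satisfies `E₀^per(n,ℓ) + θ/ℓ² ≤ periodicEnergy v Ψ` — the conclusion of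
`GPWindowSectorGap` for these `(v, n, ℓ, θ)`. [folklore] -/
theorem gpw_sectorGap_of_groundState_le (v : ℝ → ℝ≥0∞) (hℓ : 0 < ℓ) {m : Fin 3 → ℤ} (hm : m ≠ 0)
    (Ψ : PeriodicTrialState n ℓ)
    (hB : ∀ (X : Config n) (s : EuclideanSpace ℝ (Fin 3)),
        Ψ.ψ (fun j => X j + s) =
          Complex.exp (Complex.I * ↑(2 * Real.pi / ℓ * ∑ t : Fin 3, (m t : ℝ) * s t)) * Ψ.ψ X)
    {θ : ℝ}
    (hE : periodicGroundStateEnergy v n ℓ + ENNReal.ofReal (θ / ℓ ^ 2) ≤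
      ENNReal.ofReal ((2 * Real.pi / ℓ) ^ 2)) :
    periodicGroundStateEnergy v n ℓ + ENNReal.ofReal (θ / ℓ ^ 2) ≤ periodicEnergy v Ψ :=
  hE.trans (gpw_energy_floor v hℓ hm Ψ hB)

/-- `θ/ℓ² ≤ (2π/ℓ)²` for `θ ≤ 4π²`. [folklore] -/
theorem gpw_div_sq_le (hℓ : 0 < ℓ) {θ : ℝ} (hθ : θ ≤ 4 * Real.pi ^ 2) :
    θ / ℓ ^ 2 ≤ (2 * Real.pi / ℓ) ^ 2 := by
  rw [div_pow, div_le_div_iff_of_pos_right (by positivity)]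
  nlinarith

/-- **The free gas satisfies `GPWindowSectorGap`'s body verbatim** (all `n`, `θ = 4π²`, any `M`, `ℓ₀`):
`scatteringLength 0 = 0` makes the window void, `E₀^per(0,n,ℓ) = 0`, and the floor is `(2π/ℓ)²`.
Calibration: `θ ≤ 4π²` is forced (the bound is attained on `∑ⱼ e^{ik·xⱼ}`). [folklore] -/
theorem gpw_free (M : ℝ) :
    ∃ θ : ℝ, 0 < θ ∧ ∃ ℓ₀ : ℝ, ∀ ℓ : ℝ, ℓ₀ ≤ ℓ → 0 < ℓ → ∀ n : ℕ,
      (n : ℝ) * (scatteringLength 0).toReal ≤ M ^ 2 * ℓ → ∀ m : Fin 3 → ℤ, m ≠ 0 →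
      ∀ Ψ : PeriodicTrialState n ℓ,
        (∀ (X : Config n) (s : EuclideanSpace ℝ (Fin 3)),
          Ψ.ψ (fun j => X j + s) =
            Complex.exp (Complex.I * ↑(2 * Real.pi / ℓ * ∑ t : Fin 3, (m t : ℝ) * s t)) * Ψ.ψ X) →
        periodicGroundStateEnergy 0 n ℓ + ENNReal.ofReal (θ / ℓ ^ 2) ≤ periodicEnergy 0 Ψ := by
  refine ⟨4 * Real.pi ^ 2, by positivity, 0, fun ℓ _ hℓ n _ m hm Ψ hB => ?_⟩
  refine gpw_sectorGap_of_groundState_le 0 hℓ hm Ψ hB ?_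
  rw [periodicGroundStateEnergy_zero_eq_zero n hℓ, zero_add]
  exact ENNReal.ofReal_le_ofReal (gpw_div_sq_le hℓ le_rfl)

/-- **`GPWindowSectorGap`'s conclusion for `n ≤ 1`, every potential, `θ ≤ 4π²`.** For `n = 0` no Bloch
state with `m ≠ 0` exists (the kinetic floor is positive while `|∇Ψ|² ≡ 0`); for `n = 1`,
`E₀^per(1,ℓ) = 0` (`periodicGroundStateEnergy_one`) and the floor applies. [folklore] -/
theorem gpw_of_le_one (v : ℝ → ℝ≥0∞) (hℓ : 0 < ℓ) (hn : n ≤ 1) {m : Fin 3 → ℤ} (hm : m ≠ 0)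
    (Ψ : PeriodicTrialState n ℓ)
    (hB : ∀ (X : Config n) (s : EuclideanSpace ℝ (Fin 3)),
        Ψ.ψ (fun j => X j + s) =
          Complex.exp (Complex.I * ↑(2 * Real.pi / ℓ * ∑ t : Fin 3, (m t : ℝ) * s t)) * Ψ.ψ X)
    {θ : ℝ} (hθ : θ ≤ 4 * Real.pi ^ 2) :
    periodicGroundStateEnergy v n ℓ + ENNReal.ofReal (θ / ℓ ^ 2) ≤ periodicEnergy v Ψ := by
  rcases Nat.le_one_iff_eq_zero_or_eq_one.mp hn with rfl | rfl
  · -- `n = 0`: the sector is empty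
    exfalso
    have h := gpw_kinetic_floor hℓ hm Ψ hB
    have h0 : (∫⁻ X in cellN 0 ℓ, kineticDensity Ψ.ψ X) = 0 := by
      refine (lintegral_congr fun X => ?_).trans lintegral_zero
      simp [kineticDensity]
    rw [h0, nonpos_iff_eq_zero, ENNReal.ofReal_eq_zero] at h
    exact absurd h (not_le.mpr (by positivity))
  · refine gpw_sectorGap_of_groundState_le v hℓ hm Ψ hB ?_
    rw [periodicGroundStateEnergy_one hℓ v, zero_add]
    exact ENNReal.ofReal_le_ofReal (gpw_div_sq_le hℓ hθ)

end Summit.AtomisticToContinuum.BoseEinsteinCondensation.Theorems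

end
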